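import Summits.QuantumFields.YangMills.Theorems.UnitScaleTiltProp7NumericWindowsInhabitedV3
import HarnessLib

/-!
# Route `UnitScaleTilt`, crux K1 child «MinimiserStabilityRegPr» (stmt-QuantumFields-19200), stub `stub_existenceMinimalOrbit` (EX), route (α) — **«NUMERICS-CENSUS» AT S25ᴸ∕S26ᴸ v2 (RE-CUT)**
# (EX namer ★w2-19200 g8 2026-08-29T04:02:11Z «px14 g3: please RE-CUT the S25 census from … S26ᴸ 2580849c — same windows: sign binders are now `hB₀ hC₄ ha₃ hα hr hM hCH hδH hCΔ hδΔ hg0 hk139π0 hC349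
# hδ349 hCKπ hδKπ hCKΔ hδKΔ hCC hδC`; windows unchanged in name, `hC4 hMdoor` carry the five formulas»; supersedes ✓p693777's S25 census on the OLD bytes f3cb48c0): ALL twenty-one L-only windows of
# the display S26ᴸ v2 (`…StubEXOfChartPiecesTwS26L`, namer's bytes sha16 2580849cbc0465e5; = S25ᴸ v2 d83f39f5's windows) TOGETHER WITH the positivity binders `hef hα ha₃ hr hC₄ hM` ARE JOINTLY
# INHABITED for every block size and all admissible letters (`B₀ > 0`; kernel-decay letters `CH δH CΔ δΔ` (★px6), `C349 δ349 CKπ δKπ CKΔ δKΔ CC δC` (★px5 OPROW doors), `g ≥ 0` (★px18 (157)), `k139π ≥ 0`)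
# — row texts VERBATIM (`hqΘ hC4` with the Θ-formulas and `c137π ↦ 3·CKπ·(2(1+1∕δKπ))³`; `hMdoor` with `kTJ ↦ 12·α·ΘH-formula·g`, `k349∕cC∕c137∕c137π ↦ their formulas`; `hWe2 hWε2` = ★px16's windows).

Cell `ym3-torus`, width seat `ym3-torus-px14` (gen 3).  THEOREMS ONLY (0 `def`, 0 `sorry`); `--supports stmt-QuantumFields-19200 --as helper`; count-neutral.  YM₃ on T³ is a ladder rung (R3),
NOT the Clay problem; nothing here claims the stub, the crux, d = 4 or the mass gap.  PURE REAL ARITHMETIC: ✓`numericWindows_inhabited_family_v3` (p693499) instantiated at the seven formulas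
(β), `kTJ` at `α := 1`, plus ONE `gcongr` with `α ≤ 1` (from `hWε2`) for `hMdoor`'s α-dependent `kTJ` slot.  HONEST SCOPE: arithmetic only; nothing about the letters' suppliers.

References: T. Bałaban, CMP **102** (1985) 277–309 [Balaban1985Variational] (Thm 1 p.279, (70)–(77) pp.289–290, Prop. 4 (97)–(98) pp.292–293, (118)–(121) p.295, (136)–(140) pp.298–299);
CMP **99** (1985) 389–434 [Balaban1985BackgroundPropagators] ((3.49) p.399, (3.133) p.422, Thm 3.3 (3.46)); CMP **98** (1985) 17–51 [Balaban1985Averaging] (Prop. 5 (157) p.42).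
-/

set_option autoImplicit false

noncomputable section

namespace Summit.QuantumFields.YangMills.Theorems.Prop7NumericWindowsInhabited

set_option maxHeartbeats 400000 in
/-- ★★★ **«NUMERICS-CENSUS» AT S26ᴸ v2 — the display's twenty-one L-only windows + the six positivity binders are jointly inhabited by explicit constants `ef α a₃ r ε′ εC C₄ M`**, for all
admissible letters (module docstring); row texts = S26ᴸ v2's (= S25ᴸ v2's) binders VERBATIM.  Proof: ✓`numericWindows_inhabited_family_v3` at `ΘH ΘΔ G kTJ k349 cC c137 c137π :=` the formulas
(`kTJ` at `α := 1`), then `α ≤ 1` in `hMdoor`'s `kTJ` slot. [cite: Balaban1985Variational, Thm 1 p.279, (70)–(77) pp.289–290, Prop. 4 (97)–(98) pp.292–293, (118)–(121) p.295, (136)–(140) pp.298–299] -/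
theorem numericWindows_inhabited_family_S26
    (B₀ k139π CH δH CΔ δΔ g C349 δ349 CKπ δKπ CKΔ δKΔ CC δC : ℕ → ℝ)
    (hB₀ : ∀ L, 1 < L → 0 < B₀ L)
    (hCH : ∀ L, 1 < L → 0 ≤ CH L)
    (hδH : ∀ L, 1 < L → 0 < δH L)
    (hCΔ : ∀ L, 1 < L → 0 ≤ CΔ L)
    (hδΔ : ∀ L, 1 < L → 0 < δΔ L)
    (hg0 : ∀ L : ℕ, 1 < L → 0 ≤ g L)
    (hk139π0 : ∀ L : ℕ, 1 < L → 0 ≤ k139π L)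
    (hC349 : ∀ L, 1 < L → 0 ≤ C349 L)
    (hδ349 : ∀ L, 1 < L → 0 < δ349 L)
    (hCKπ : ∀ L, 1 < L → 0 ≤ CKπ L)
    (hδKπ : ∀ L, 1 < L → 0 < δKπ L)
    (hCKΔ : ∀ L, 1 < L → 0 ≤ CKΔ L)
    (hδKΔ : ∀ L, 1 < L → 0 < δKΔ L)
    (hCC : ∀ L, 1 < L → 0 ≤ CC L)
    (hδC : ∀ L, 1 < L → 0 < δC L) :
    ∃ ef α a₃ r ε' εC C₄ M : ℕ → ℝ,
      (∀ L, 1 < L → 0 < ef L) ∧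
      (∀ L, 1 < L → 0 < α L) ∧
      (∀ L, 1 < L → 0 < a₃ L) ∧
      (∀ L, 1 < L → 0 < r L) ∧
      (∀ L, 1 < L → 0 < C₄ L) ∧
      (∀ L, 1 < L → 0 < M L) ∧
      (∀ L : ℕ, 1 < L → 13 * 10 ^ 14 * (L : ℝ) ^ 3 * α L ≤ 1) ∧
      (∀ L : ℕ, 1 < L → 10 ^ 9 * (L : ℝ) ^ 2 * ef L ≤ 1) ∧
      (∀ L : ℕ, 1 < L → 10 ^ 12 * (L : ℝ) ^ 3 * α L ≤ 1) ∧
      (∀ L, 1 < L → M L * α L < ef L) ∧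
      (∀ L : ℕ, 1 < L → 10 ^ 7 * (L : ℝ) ^ 3 * (178 * (α L + ef L)) ≤ 1) ∧
      (∀ L : ℕ, 1 < L → 9 * (40 * (2 * (3 * (2 * ef L + 2700 * (L : ℝ) * α L))) / ef L ^ 2) * B₀ L * ε' L < 1) ∧
      (∀ L : ℕ, 1 < L → 6 * ε' L ≤ ef L) ∧
      (∀ L : ℕ, 1 < L → 2 * (r L + 2 * B₀ L * α L) ≤ ε' L) ∧
      (∀ L : ℕ, 1 < L → 0 ≤ εC L) ∧
      (∀ L : ℕ, 1 < L → 2 * (εC L + a₃ L) ≤ ef L / 2) ∧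
      (∀ L : ℕ, 1 < L → B₀ L * (40 * (2 * (3 * (2 * ef L + 2700 * (L : ℝ) * α L))) / ef L ^ 2) * (εC L + a₃ L) ^ 2 ≤ εC L) ∧
      (∀ L : ℕ, 1 < L → 4 * B₀ L * (40 * (2 * (3 * (2 * ef L + 2700 * (L : ℝ) * α L))) / ef L ^ 2) * (εC L + a₃ L) < 1) ∧
      (∀ L : ℕ, 1 < L → 2 * B₀ L * α L ≤ r L) ∧
      (∀ L : ℕ, 1 < L → 4 * r L ≤ a₃ L) ∧
      (∀ L : ℕ, 1 < L → 16 * B₀ L * C₄ L * r L ≤ 1) ∧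
      (∀ L, 1 < L → (εC L + a₃ L) * (3 * CH L * (2 * (1 + 2 / δH L)) ^ 3) * (6 * g L) ≤ 1 / 2) ∧
      (∀ L, 1 < L → a₃ L ≤ (1 - 4 * B₀ L * (40 * (2 * (3 * (2 * ef L + 2700 * (L : ℝ) * α L))) / ef L ^ 2) * (εC L + a₃ L)) * (1 / 16)) ∧
      (∀ L, 1 < L → 1 * 2 * ((2 * (1 / (1 - 4 * B₀ L * (40 * (2 * (3 * (2 * ef L + 2700 * (L : ℝ) * α L))) / ef L ^ 2) * (εC L + a₃ L))) + 1) * ((3 * CH L * (2 * (1 + 2 / δH L)) ^ 3) * (6 * g L)) / a₃ L) * α L + (((3 * CKπ L * (2 * (1 + 1 / δKπ L)) ^ 3) + k139π L * B₀ L) * (40 * (2 * (3 * (2 * ef L + 2700 * (L : ℝ) * α L))) / ef L ^ 2) * (1 / (1 - 4 * B₀ L * (40 * (2 * (3 * (2 * ef L + 2700 * (L : ℝ) * α L))) / ef L ^ 2) * (εC L + a₃ L))) ^ 2 + 1 * 2 * (2 * (3 * CΔ L * (2 * (1 + 1 / δΔ L)) ^ 3) * (6 * g L) * (1 / (1 -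 4 * B₀ L * (40 * (2 * (3 * (2 * ef L + 2700 * (L : ℝ) * α L))) / ef L ^ 2) * (εC L + a₃ L)))))
            + 1 * 2 * (2 * (3 * CH L * (2 * (1 + 2 / δH L)) ^ 3) * (6 * g L) * (1 / (1 - 4 * B₀ L * (40 * (2 * (3 * (2 * ef L + 2700 * (L : ℝ) * α L))) / ef L ^ 2) * (εC L + a₃ L)))) * (((3 * CKπ L * (2 * (1 + 1 / δKπ L)) ^ 3) + k139π L * B₀ L) * (40 * (2 * (3 * (2 * ef L + 2700 * (L : ℝ) * α L))) / ef L ^ 2) * (1 / (1 - 4 * B₀ L * (40 * (2 * (3 * (2 * ef L + 2700 * (L : ℝ) * α L))) / ef L ^ 2) * (εC L + a₃ L))) ^ 2) * a₃ L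
            + 1 * 2 * (1 + (2 * (3 * CH L * (2 * (1 + 2 / δH L)) ^ 3) * (6 * g L) * (1 / (1 - 4 * B₀ L * (40 * (2 * (3 * (2 * ef L + 2700 * (L : ℝ) * α L))) / ef L ^ 2) * (εC L + a₃ L)))) * a₃ L) * (2 * (1024 * ((3 - 1 : ℕ) : ℝ) * 1 * (α L + 1 / 16) + ((3 - 1 : ℕ) : ℝ) * 138 * 1)) * (1 / (1 - 4 * B₀ L * (40 * (2 * (3 * (2 * ef L + 2700 * (L : ℝ) * α L))) / ef L ^ 2) * (εC L + a₃ L))) ^ 2 ≤ C₄ L) ∧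
      (∀ L : ℕ, 1 < L → 10 ^ 15 * (L : ℝ) ^ 2 * ef L ≤ 1) ∧
      (∀ L : ℕ, 1 < L → 10 ^ 18 * (L : ℝ) ^ 3 * α L ≤ 1) ∧
      (∀ L : ℕ, 1 < L → 11 * B₀ L + 4 * B₀ L * (40 * (2 * (3 * (2 * ef L + 2700 * (L : ℝ) * α L))) / ef L ^ 2) * (11 * B₀ L) ^ 2 * α L + ((1 + 25 * C₄ L * B₀ L ^ 2) + (3 * CC L * (2 * (1 + 1 / δC L)) ^ 3) * (1 + 25 * C₄ L * B₀ L ^ 2) + (3 * CKΔ L * (2 * (1 + 1 / δKΔ L)) ^ 3) * 2 + (12 * α L * (3 * CH L * (2 * (1 + 2 / δH L)) ^ 3) * g L) * (10 * B₀ L) / 2 + 14 * (10 * B₀ L) + (3 * C349 L * (2 * (1 + 1 / δ349 L)) ^ 3) * (10 * B₀ L) / 2 + 2 * (10 * B₀ L)) + 100 * ((3 * CKπ L * (2 * (1 + 1 / δKπ L)) ^ 3) + k139π L * B₀ L + (3 * C349 L * (2 * (1 + 1 / δ349 L)) ^ 3) * B₀ L + (28 + 4) * α L * B₀ L) * (40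 * (2 * (3 * (2 * ef L + 2700 * (L : ℝ) * α L))) / ef L ^ 2) * B₀ L ^ 2 * α L ≤ M L) := by
  classical
  have hΘH0 : ∀ L : ℕ, 1 < L → 0 ≤ (fun L => 3 * CH L * (2 * (1 + 2 / δH L)) ^ 3) L := fun L hL => by
    have := hCH L hL; have := hδH L hL; positivity
  have hΘΔ0 : ∀ L : ℕ, 1 < L → 0 ≤ (fun L => 3 * CΔ L * (2 * (1 + 1 / δΔ L)) ^ 3) L := fun L hL => by
    have := hCΔ L hL; have := hδΔ L hL; positivity
  have hG0 : ∀ L : ℕ, 1 < L → 0 ≤ (fun L => 6 * g L) L := fun L hL => by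
    have := hg0 L hL; positivity
  have hk349 : ∀ L : ℕ, 1 < L → 0 ≤ (fun L => 3 * C349 L * (2 * (1 + 1 / δ349 L)) ^ 3) L := fun L hL => by
    have := hC349 L hL; have := hδ349 L hL; positivity
  have hkTJ : ∀ L : ℕ, 1 < L → 0 ≤ (fun L => 12 * 1 * (3 * CH L * (2 * (1 + 2 / δH L)) ^ 3) * g L) L := fun L hL => by
    have := hCH L hL; have := hδH L hL; have := hg0 L hL; positivity
  have hcC : ∀ L : ℕ, 1 < L → 0 ≤ (fun L => 3 * CC L * (2 * (1 + 1 / δC L)) ^ 3) L := fun L hL => by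
    have := hCC L hL; have := hδC L hL; positivity
  have hc137 : ∀ L : ℕ, 1 < L → 0 ≤ (fun L => 3 * CKΔ L * (2 * (1 + 1 / δKΔ L)) ^ 3) L := fun L hL => by
    have := hCKΔ L hL; have := hδKΔ L hL; positivity
  have hc137π : ∀ L : ℕ, 1 < L → 0 ≤ (fun L => 3 * CKπ L * (2 * (1 + 1 / δKπ L)) ^ 3) L := fun L hL => by
    have := hCKπ L hL; have := hδKπ L hL; positivity
  have hk' : ∀ L : ℕ, 1 < L → 0 ≤ (fun L => 3 * CC L * (2 * (1 + 1 / δC L)) ^ 3) L ∧ 0 ≤ (fun L => 3 * CKΔ L * (2 * (1 + 1 / δKΔ L)) ^ 3) L ∧ 0 ≤ (fun L => 12 * 1 * (3 * CH L * (2 * (1 + 2 / δH L)) ^ 3) * g L) L ∧ 0 ≤ (fun L => 3 * C349 L * (2 * (1 + 1 / δ349 L)) ^ 3) L ∧ 0 ≤ (fun L => 3 * CKπ L * (2 * (1 + 1 / δKπ L)) ^ 3) L ∧ 0 ≤ k139π L :=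
    fun L hL => ⟨hcC L hL, hc137 L hL, hkTJ L hL, hk349 L hL, hc137π L hL, hk139π0 L hL⟩
  obtain ⟨ef, α, a₃, r, ε', εC, C₄, M, hef, hα, ha₃, hr, hC₄, hM, hWQ, hWe, hWε, hMe, hw137, hq47, hR6, hrε2, hεC, hdomC, hselfC, hcontrC,
      hrα, hr4, hr16, hqΘ, hR16, hC4, -, hWe2, hWε2, hMdoor⟩ :=
    numericWindows_inhabited_family_v3 B₀ (fun L => 3 * CC L * (2 * (1 + 1 / δC L)) ^ 3) (fun L => 3 * CKΔ L * (2 * (1 + 1 / δKΔ L)) ^ 3) (fun L => 12 * 1 * (3 * CH L * (2 * (1 + 2 / δH L)) ^ 3) * g L) (fun L => 3 * C349 L * (2 * (1 + 1 / δ349 L)) ^ 3) (fun L => 3 * CKπ L * (2 * (1 + 1 / δKπ L)) ^ 3) k139π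
      (fun L => 3 * CH L * (2 * (1 + 2 / δH L)) ^ 3) (fun L => 3 * CΔ L * (2 * (1 + 1 / δΔ L)) ^ 3) (fun L => 6 * g L) hB₀ hk' hΘH0 hΘΔ0 hG0
  refine ⟨ef, α, a₃, r, ε', εC, C₄, M, hef, hα, ha₃, hr, hC₄, hM, hWQ, hWe, hWε, hMe, hw137, hq47, hR6, hrε2, hεC, hdomC, hselfC, hcontrC,
    hrα, hr4, hr16, hqΘ, hR16, hC4, hWe2, hWε2, ?_⟩
  -- hMdoor: the display's `kTJ` slot carries `α L`; the v3 instance carries `1`; `α ≤ 1` from `hWε2`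
  intro L hL
  have h := hMdoor L hL
  have hL1 : (1 : ℝ) ≤ (L : ℝ) := by exact_mod_cast hL.le
  have hα1 : α L ≤ 1 := by
    have hw := hWε2 L hL
    have hα0 := (hα L hL).le
    nlinarith [one_le_pow₀ (n := 3) hL1]
  have hB := (hB₀ L hL).le; have hC := hCH L hL; have hδ := hδH L hL; have hg := hg0 L hL
  refine le_trans ?_ h
  gcongr
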